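import Mathlib
import Summits.AtomisticToContinuum.Crystallization.Theorems.ChargedEnergyGap.Negative.Unconditional
import Summits.AtomisticToContinuum.Crystallization.Theorems.ChessboardParticlePlanesLjLaminarWindowsWindowFloor
import Summits.AtomisticToContinuum.Crystallization.Theorems.ChessboardParticlePlanesLjLaminarWindowsGoodCentre
import Summits.AtomisticToContinuum.Crystallization.Theorems.ChessboardParticlePlanesLjLaminarWindowsAveragingIntegrals
import Literature.MathematicalPhysics.StatisticalMechanics.LennardJonesClusters
import HarnessLib

/-!
# Energy-good centre balls of Lennard-Jones ground states away from any sparse set (unconditional)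

Support file for crux stmt-AtomisticToContinuum-6711 (`ChessboardParticlePlanes.LjLaminarWindows`), line `Sketch`:
the UNCONDITIONAL core of the line's averaging argument.  For every sequence of Lennard-Jones ground
states and every `ε > 0` there is `L₀` such that for every `L ≥ L₀` some density `θ > 0` works: if
`#bad_N ≤ θN` eventually, then eventually in `N` there is a CENTRE `c ∈ ℝ³` whose closed `L`-ball contains a
particle, contains it at energy `E_int(B_L(c)) ≤ 2(e* + ε)·#B_L(c)` (ordered-pair Lennard-Jones sum over the
particles within `L` of `c`), and has NO bad particle within distance `1` of `c`.  (Passing from such a centre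
to a particle-centred window needs a no-foam input; see `stub_energyGoodWindows`.)

Proof: continuous averaging of `G(c) = E_int(B_L(c)) − 2(e*+ε')#B_L(c)` over `c ∈ ℝ³` (`averagingIntegrals`,
p103618: `∫ G ≤ 2|B_L|·𝓔 + 530δ⁻⁵L²N − 2(e*+ε')N|B_L| ≤ −ε'N|B_L|/2` once `E(N) ≤ N(e*+ε'/4)`
(`crysEnergyLimit`) and `530δ⁻⁵L² ≤ ε'|B_L|`), the floor `G ≥ −2ε'#B_L(c)` (`windowFloor`, p103349), and the
selection `goodCentre` (p103339) off the union of unit balls about bad particles, whose weight is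
`≤ #bad · (2L/δ+1)³ · |B_L|` (`card_le_of_separated_of_dist_le`).  All `[folklore]`.
-/

noncomputable section

open scoped BigOperators
open MeasureTheory Metric Filter Topology
open Literature.MathematicalPhysics.StatisticalMechanics
open Summit.AtomisticToContinuum.Crystallization.Theorems.ChargedEnergyGapNegative

namespace Summit.AtomisticToContinuum.Crystallization.Theorems.LjLaminarWindowsSketch

/-- **Energy-good centre balls away from a sparse set (unconditional; registered stub `stub_energyGoodCentres` of line `Sketch`).** For every sequence of
Lennard-Jones ground states and `ε > 0` there is `L₀` such that for every `L ≥ L₀` some density `θ > 0`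
works: if `#bad_N ≤ θN` eventually, then eventually in `N` some centre `c` has a non-empty `L`-ball with
`Σ_{j≠k ∈ B_L(c)} V_LJ ≤ 2(e* + ε)·#B_L(c)` and no bad particle within `1` of `c`. [folklore] -/
theorem stub_energyGoodCentres :
    ∀ x : (N : ℕ) → (Fin N → E3), (∀ N, IsGroundState lennardJones (x N)) → ∀ ε : ℝ, 0 < ε →
    ∃ L₀ : ℝ, ∀ L : ℝ, L₀ ≤ L → ∃ θ : ℝ, 0 < θ ∧ ∀ bad : (N : ℕ) → Finset (Fin N),
      (∀ᶠ N : ℕ in atTop, ((bad N).card : ℝ) ≤ θ * N) →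
      ∀ᶠ N : ℕ in atTop, ∃ c : E3, (∀ u ∈ bad N, 1 < dist (x N u) c) ∧
        0 < (Finset.univ.filter fun j : Fin N => dist (x N j) c ≤ L).card ∧
        (∑ j : Fin N, ∑ k : Fin N, if j ≠ k ∧ dist (x N j) c ≤ L ∧ dist (x N k) c ≤ L
            then lennardJones (dist (x N j) (x N k)) else 0) ≤
          2 * (eStar + ε) * ((Finset.univ.filter fun j : Fin N => dist (x N j) c ≤ L).card : ℝ) := by
  intro x hx ε hε
  obtain ⟨δ, hδ, hsep⟩ := LennardJonesMinimalDistance_holds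
  -- `e* < 0`
  have he : eStar < 0 := by
    obtain ⟨e, he, htend, -⟩ := BlancLewin2015_8_holds 3 (by norm_num) (by norm_num)
    have heq : e = eStar := tendsto_nhds_unique htend crysEnergyLimit
    rw [← heq]
    exact he
  set ε₁ : ℝ := min ε (-eStar) with hε₁
  have hε₁pos : 0 < ε₁ := lt_min hε (neg_pos.2 he)
  have hε₁le : ε₁ ≤ ε := min_le_left _ _
  set ε' : ℝ := ε₁ / 2 with hε'
  have hε'pos : 0 < ε' := by positivity
  have hε'le : ε' ≤ ε := by linarith
  set C : ℝ := 530 * δ⁻¹ ^ 5 with hC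
  have hC0 : 0 ≤ C := by positivity
  set L₀ : ℝ := max 1 (C / (4 / 3 * Real.pi * ε')) with hL₀
  refine ⟨L₀, fun L hL => ?_⟩
  have hL1 : 1 ≤ L := le_trans (le_max_left _ _) hL
  have hLpos : 0 < L := by linarith
  set v : ℝ := 4 / 3 * Real.pi * L ^ 3 with hv
  have hvpos : 0 < v := by positivity
  have hCL : C * L ^ 2 ≤ ε' * v := by
    have h1 : C / (4 / 3 * Real.pi * ε') ≤ L := le_trans (le_max_right _ _) hL
    have hpos : 0 < 4 / 3 * Real.pi * ε' := by positivity
    rw [div_le_iff₀ hpos] at h1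
    have h2 := mul_le_mul_of_nonneg_right h1 (sq_nonneg L)
    have h3 : L * (4 / 3 * Real.pi * ε') * L ^ 2 = ε' * v := by rw [hv]; ring
    linarith
  set P : ℝ := (2 * L / δ + 1) ^ 3 with hP
  have hPpos : 0 < P := by positivity
  set θ : ℝ := 1 / (8 * P) with hθ
  have hθpos : 0 < θ := by positivity
  refine ⟨θ, hθpos, fun bad hbad => ?_⟩
  have hcl : Tendsto (fun N : ℕ => groundStateEnergy lennardJones 3 N / N) atTop (𝓝 eStar) :=
    crysEnergyLimit
  have hlt : eStar < eStar + ε' / 4 := by linarith only [hε'pos]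
  have hE1 : ∀ᶠ N : ℕ in atTop, groundStateEnergy lennardJones 3 N / N < eStar + ε' / 4 :=
    hcl.eventually (gt_mem_nhds hlt)
  have hE4 : ∀ᶠ N : ℕ in atTop, 1 ≤ N := eventually_ge_atTop 1
  refine (hE1.and (hbad.and hE4)).mono ?_
  rintro N ⟨h1, h2, h4⟩
  classical
  have hxN := hx N
  have hinj : Function.Injective (x N) := hxN.1
  have hsepN : ∀ j k : Fin N, j ≠ k → δ ≤ dist (x N j) (x N k) :=
    fun j k hjk => hsep N (x N) hxN j k hjk
  have hNpos : (0 : ℝ) < N := by exact_mod_cast h4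
  have hEN : interactionEnergy lennardJones (x N) ≤ N * (eStar + ε' / 4) := by
    rw [hxN.2]
    have h1' := h1
    rw [div_lt_iff₀ hNpos] at h1'
    linarith only [h1']
  obtain ⟨hbc_int, -, hbe_int, hbc_eq, -, hbe_le⟩ := averagingIntegrals N (x N) δ L hδ hL1 hinj hsepN
  set bc : E3 → ℝ := fun c => ((Finset.univ.filter fun j : Fin N => dist (x N j) c ≤ L).card : ℝ)
    with hbc
  set be : E3 → ℝ := fun c => ∑ j : Fin N, ∑ k : Fin N,
    if j ≠ k ∧ dist (x N j) c ≤ L ∧ dist (x N k) c ≤ L then lennardJones (dist (x N j) (x N k)) else 0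
    with hbe
  set G : E3 → ℝ := fun c => be c - 2 * (eStar + ε') * bc c with hG
  have hbc_nonneg : ∀ c, 0 ≤ bc c := fun c => by simp only [hbc]; positivity
  have hfloor : ∀ c, 2 * eStar * bc c ≤ be c := fun c => windowFloor N (x N) hinj c L
  have hGfloor : ∀ c, -(2 * ε' * bc c) ≤ G c := by
    intro c
    have h1 := hfloor c
    simp only [hG]
    linarith only [h1]
  have hbc_leP : ∀ c, bc c ≤ P := by
    intro c
    set F : Finset (Fin N) := Finset.univ.filter fun j : Fin N => dist (x N j) c ≤ L with hF
    have hcard : ((F.image (x N)).card : ℝ) = bc c := by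
      simp only [hbc]
      rw [Finset.card_image_of_injective _ hinj]
    have h := card_le_of_separated_of_dist_le (F.image (x N)) c hδ hLpos.le ?_ ?_
    · rw [finrank_euclideanSpace_fin] at h
      rw [← hcard]
      simpa [hP] using h
    · intro p hp
      obtain ⟨j, hj, rfl⟩ := Finset.mem_image.1 hp
      exact (Finset.mem_filter.1 hj).2
    · intro p hp q hq hpq
      obtain ⟨j, -, rfl⟩ := Finset.mem_image.1 hp
      obtain ⟨k, -, rfl⟩ := Finset.mem_image.1 hq
      exact hsepN j k fun h => hpq (h ▸ rfl)
  have hG_int : Integrable G := hbe_int.sub (hbc_int.const_mul (2 * (eStar + ε')))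
  set A : ℝ := ε' * N * v / 2 with hA
  have hApos : 0 < A := by positivity
  have hG_integral : (∫ c, G c) ≤ -A := by
    have hsplit : (∫ c, G c) = (∫ c, be c) - 2 * (eStar + ε') * (∫ c, bc c) := by
      simp only [hG]
      rw [integral_sub hbe_int (hbc_int.const_mul _), integral_const_mul]
    rw [hsplit, hbc_eq]
    have hbe_le' : (∫ c, be c) ≤
        v * (2 * interactionEnergy lennardJones (x N)) + 530 * δ⁻¹ ^ 5 * L ^ 2 * N := hbe_le
    have ha' : v * (2 * interactionEnergy lennardJones (x N)) ≤
        2 * (v * N * eStar) + 1 / 2 * (v * N * ε') := by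
      have h1 := mul_le_mul_of_nonneg_left hEN (by positivity : (0 : ℝ) ≤ 2 * v)
      have h2 : 2 * v * (N * (eStar + ε' / 4)) = 2 * (v * N * eStar) + 1 / 2 * (v * N * ε') := by ring
      have h3 : v * (2 * interactionEnergy lennardJones (x N)) =
          2 * v * interactionEnergy lennardJones (x N) := by ring
      linarith only [h1, h2, h3]
    have hc : 530 * δ⁻¹ ^ 5 * L ^ 2 * N = C * L ^ 2 * N := by simp only [hC]
    have hd : C * L ^ 2 * N ≤ v * N * ε' := by
      have := mul_le_mul_of_nonneg_right hCL hNpos.le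
      have h' : ε' * v * N = v * N * ε' := by ring
      linarith only [this, h']
    have he2 : 2 * (eStar + ε') * (↑N * (4 / 3 * Real.pi * L ^ 3)) =
        2 * (v * N * eStar) + 2 * (v * N * ε') := by
      simp only [hv]; ring
    have hA' : -A = -(1 / 2) * (v * N * ε') := by simp only [hA]; ring
    rw [he2, hA']
    linarith only [hbe_le', ha', hc, hd]
  -- the bad set: unit balls about bad particles
  set D : Set E3 := ⋃ u ∈ bad N, closedBall (x N u) 1 with hD
  have hD_closed : IsClosed D := isClosed_biUnion_finset fun u _ => isClosed_closedBall
  have hD_meas : MeasurableSet D := hD_closed.measurableSet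
  have hcover : ∀ c ∈ D, bc c ≠ 0 → ∃ m ∈ bad N, dist c (x N m) ≤ (fun _ : Fin N => L) m := by
    intro c hc _
    simp only [hD, Set.mem_iUnion, mem_closedBall] at hc
    obtain ⟨u, hu, hcu⟩ := hc
    exact ⟨u, hu, le_trans hcu hL1⟩
  have hsum : P * ∑ m ∈ bad N, (4 / 3 * Real.pi * ((fun _ : Fin N => L) m) ^ 3) ≤ A / (4 * ε') := by
    simp only [Finset.sum_const, nsmul_eq_mul]
    have hscard : ((bad N).card : ℝ) ≤ θ * N := h2
    have hθN : θ * N = N / (8 * P) := by simp only [hθ]; field_simp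
    have hA4 : A / (4 * ε') = N * v / 8 := by simp only [hA]; field_simp; ring
    rw [hA4]
    rw [hθN] at hscard
    have h6 : P * ((bad N).card : ℝ) ≤ N / 8 := by
      have h7 := mul_le_mul_of_nonneg_left hscard hPpos.le
      have h8 : P * (N / (8 * P)) = N / 8 := by field_simp
      linarith only [h7, h8]
    have hv' : (4 / 3 * Real.pi * L ^ 3) = v := rfl
    rw [hv']
    have h9 := mul_le_mul_of_nonneg_right h6 hvpos.le
    have e1 : P * (((bad N).card : ℝ) * v) = P * ((bad N).card : ℝ) * v := by ring
    have e2 : (N : ℝ) / 8 * v = N * v / 8 := by ring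
    linarith only [h9, e1, e2]
  obtain ⟨c, hcD, hGc⟩ := goodCentre G bc D N (bad N) (x N) (fun _ => L) A ε' P hε'pos hApos hPpos.le
    hG_int hbc_int hGfloor hbc_nonneg hbc_leP hG_integral hD_meas hcover (fun _ _ => hLpos.le) hsum
  refine ⟨c, ?_, ?_, ?_⟩
  · intro u hu
    by_contra h
    apply hcD
    simp only [hD, Set.mem_iUnion, mem_closedBall]
    exact ⟨u, hu, by rw [dist_comm]; exact le_of_not_gt h⟩
  · -- the ball is non-empty: otherwise `G c = 0`
    by_contra h0
    have hcard0 : (Finset.univ.filter fun j : Fin N => dist (x N j) c ≤ L).card = 0 := by omega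
    have hempty := Finset.card_eq_zero.1 hcard0
    have hbc0 : bc c = 0 := by simp only [hbc, hcard0, Nat.cast_zero]
    have hbe0 : be c = 0 := by
      simp only [hbe]
      refine Finset.sum_eq_zero fun j _ => Finset.sum_eq_zero fun k _ => ?_
      rw [if_neg]
      rintro ⟨-, hj, -⟩
      have : j ∈ Finset.univ.filter fun j : Fin N => dist (x N j) c ≤ L :=
        Finset.mem_filter.2 ⟨Finset.mem_univ _, hj⟩
      rw [hempty] at this
      exact absurd this (Finset.notMem_empty _)
    have : G c = 0 := by simp only [hG, hbc0, hbe0]; ring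
    linarith only [hGc, this]
  · have h := hGc
    simp only [hG] at h
    have hb := hbc_nonneg c
    have : 2 * (eStar + ε') * bc c ≤ 2 * (eStar + ε) * bc c :=
      mul_le_mul_of_nonneg_right (by linarith only [hε'le]) hb
    show be c ≤ 2 * (eStar + ε) * bc c
    linarith only [h, this]

end Summit.AtomisticToContinuum.Crystallization.Theorems.LjLaminarWindowsSketch

end
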